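import Literature.NumberTheory.Automorphic.ShimuraCurveRibetTakahashi
import Literature.NumberTheory.EllipticCurves.ModularCurveNeronLatticeProofs
import Literature.NumberTheory.EllipticCurves.ComplexTorusAddProofs
import Literature.NumberTheory.EllipticCurves.UniformizationUniqueProofs
import HarnessLib

/-!
# Existence of Shimura-curve parametrisation data: the uniformisation half is a theorem
# (proofs-only sibling of `ShimuraCurveRibetTakahashi.lean`; theorems only, D-0026)

Topic `NumberTheory/Automorphic`. The named fact
`Literature.NumberTheory.Automorphic.nonempty_shimuraParametrizationData`
(`ShimuraCurveRibetTakahashi.lean`; H. Pasten, *Shimura curves and the abc conjecture*, §2 p. 12: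
"for each admissible factorization `N = DM`, the Jacquet–Langlands correspondence gives an optimal
quotient `q_{D,M} : J₀^D(M) → A_{D,M}` defined over `ℚ`, with `A_{D,M}` isogenous to `E`", §4.10
p. 16 (`JL : S₂^D(M) ≅ S₂(N)^D`, Hecke-equivariant away from `N`), §4.11 p. 16 (the Shimura
construction `q_{[χ]}`) and Prop. 5.1 p. 17 ("the `ℂ`-map `q j_{p₀} : X₀^D(M)^an → A_ℂ` has degree
equal to the modular degree `δ`")) asserts, for every admissible `N = D M`, every datum `X` of
level `(D, M)` and every globally minimal elliptic `W/ℚ` of conductor `N`, a datum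
`ShimuraParametrizationData X W`. Such a datum has two halves:

* the **uniformisation half** — a Néron-type period pair `L` of the model `W`
  (`g₂ = c₄/12`, `g₃ = c₆/216`) and the group isomorphism `ℂ/Λ_L ≅ W(ℂ)` given by `℘, ℘'`
  (fields `L`, `isNeronLattice`, `uniformize`, `ker_uniformize`, `uniformize_surjective`,
  `uniformize_spec`);
* the **automorphic half** — a weight-`2` form `h` on `Γ₀^D(M) = ι(O¹)` with periods in `Λ_L`, in
  the Hecke line of `W` (`T_ℓ h = a_ℓ(W) h`, `ℓ ∤ D M` prime), whose period map
  `Γ₀^D(M)τ ↦ ∫_{τ₀}^τ h (mod Λ_L)` has a degree `d ≥ 1` (exactly `d` orbits in all but finitely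
  many fibres) — mathematically: the Modularity Theorem (the newform `f_W`; the tree's named fact
  `Literature.NumberTheory.EllipticCurves.ModularForms.exists_isNewformOf`), its Jacquet–Langlands
  transfer to `S₂^D(M)` (§4.10), the Shimura construction and Faltings' isogeny theorem
  (`A_{D,M} ∼ W`, §2, §4.11), and the degree of a non-constant holomorphic map of compact Riemann
  surfaces (proof of Prop. 5.1).

This file proves that **the uniformisation half is a theorem of the tree** — Silverman AEC VI.5.1
(`exists_isNeronLatticeOf_holds`, `ModularCurveNeronLatticeProofs`) and AEC VI.3.6(b)
(`PeriodPair.exists_addMonoidHom_of_g₂_g₃'`, `ComplexTorusAddProofs`) — so that the fact is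
*equivalent* to its automorphic half stated on `ℂ/Λ_L`, with no Weierstrass points and no
uniformisation (`nonempty_shimuraParametrizationData_iff_automorphicHalf`): `→` because a datum
contains the automorphic half for EVERY Néron-type period pair of its curve (the lattice being
unique, AEC VI.5.1 uniqueness = `PeriodPair.uniformization_unique_holds`;
`ShimuraParametrizationData.automorphicHalf`), `←` by the assembly
`nonempty_shimuraParametrizationData_of_automorphicHalf`, the fibre count being transported along
`QuotientAddGroup.liftEquiv : ℂ/Λ_L ≃+ W(ℂ)`. This is the exact Shimura-curve twin of the tree's
treatment of the `D = 1` fact `nonempty_modularParametrizationData`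
(`ModularParametrization.lean`: `nonempty_modularParametrizationData_of_facts`,
`ModularParametrizationData.exists_maninConstant_modularDegree`), whose automorphic half is the
named fact `IsNewformOf.exists_maninConstant_modularDegree` there; here, under D-0026, the
automorphic half is a hypothesis binder spelled out in the statements, not a new named fact.
Nothing is restated: `nonempty_shimuraParametrizationData` itself stays the named fact of
`ShimuraCurveRibetTakahashi.lean`, open exactly until its automorphic half is a theorem.

## References

* H. Pasten, *Shimura curves and the abc conjecture*, J. Number Theory 254 (2024) 214–335 =
  arXiv:1705.09251: §2 p. 12, §4.6 p. 15, §4.10–4.11 p. 16, Prop. 5.1 p. 17 (held arXiv text, read).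
  [PastenShimura2024]
* J. H. Silverman, *The Arithmetic of Elliptic Curves*, 2nd ed., GTM 106 (2009): Prop. VI.3.6(b),
  Thm. VI.5.1. [SilvermanAEC2009]
* H. Jacquet, R. P. Langlands, *Automorphic forms on GL(2)*, LNM 114 (1970), §16.
  [JacquetLanglands1970]
-/

noncomputable section

open scoped MatrixGroups ModularForm
open _root_.MeasureTheory UpperHalfPlane

namespace Literature.NumberTheory.Automorphic

open Literature.NumberTheory.EllipticCurves.ModularForms
  (IsNeronLatticeOf exists_isNeronLatticeOf_holds)

/-! ### Transport of orbit-fibre counts along a bijection of the target -/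

section Transport

variable {Q A B : Type*} (mk : ℍ → Q) (e : A ≃ B) (g : ℍ → A)

/-- If `e : A ≃ B`, the number of classes `y : Q` (orbits `Γτ`, `mk = Quotient.mk`) having a
representative `τ` with `g τ = P` equals the number having one with `e (g τ) = e P` (the tree's
`card_fiberOrbits_congr` for an arbitrary class map `mk : ℍ → Q` in place of `Y0.mk N`). [folklore] -/
theorem card_orbitFibre_congr (P : A) :
    Nat.card {y : Q // ∃ τ : ℍ, mk τ = y ∧ e (g τ) = e P} =
      Nat.card {y : Q // ∃ τ : ℍ, mk τ = y ∧ g τ = P} :=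
  Nat.card_congr <| Equiv.subtypeEquivRight fun _ ↦
    exists_congr fun _ ↦ and_congr_right fun _ ↦ e.injective.eq_iff

/-- Finiteness of the exceptional set `{P | #(orbit-fibre over P) ≠ d}` is invariant under a
bijection `e : A ≃ B` of the target (the tree's `finite_setOf_card_fiberOrbits_ne_iff` for an
arbitrary class map `mk`). [folklore] -/
theorem finite_setOf_card_orbitFibre_ne_iff (d : ℕ) :
    {P' : B | Nat.card {y : Q // ∃ τ : ℍ, mk τ = y ∧ e (g τ) = P'} ≠ d}.Finite ↔
      {P : A | Nat.card {y : Q // ∃ τ : ℍ, mk τ = y ∧ g τ = P} ≠ d}.Finite := by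
  have hS : {P' : B | Nat.card {y : Q // ∃ τ : ℍ, mk τ = y ∧ e (g τ) = P'} ≠ d} =
      e '' {P : A | Nat.card {y : Q // ∃ τ : ℍ, mk τ = y ∧ g τ = P} ≠ d} := by
    ext P'
    simp only [Set.mem_setOf_eq, Set.mem_image]
    constructor
    · intro hP'
      refine ⟨e.symm P', ?_, e.apply_symm_apply P'⟩
      rwa [← card_orbitFibre_congr mk e g, e.apply_symm_apply]
    · rintro ⟨P, hP, rfl⟩
      rwa [card_orbitFibre_congr mk e g]
  rw [hS, Set.finite_image_iff e.injective.injOn]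

end Transport

/-! ### A datum contains its automorphic half, for every Néron-type period pair -/

namespace ShimuraParametrizationData

variable {D M : ℕ} {X : ShimuraCurveData D M} {W : WeierstrassCurve ℚ}

/-- Two Néron-type period pairs of the same model span the same lattice (they have the same
`g₂ = c₄/12`, `g₃ = c₆/216`; Silverman AEC VI.5.1, uniqueness, the tree's
`PeriodPair.uniformization_unique_holds`). In particular the lattice `Λ_L` of a datum is THE
Néron-type lattice of `W`. [cite: SilvermanAEC2009, Thm. VI.5.1 (uniqueness)] -/
theorem lattice_eq_of_isNeronLatticeOf (P : ShimuraParametrizationData X W) {L : PeriodPair}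
    (hL : IsNeronLatticeOf (W.baseChange ℂ) L) : L.lattice = P.L.lattice :=
  PeriodPair.uniformization_unique_holds L P.L (hL.1.trans P.isNeronLattice.1.symm)
    (hL.2.trans P.isNeronLattice.2.symm)

/-- **The automorphic half of a datum.** A parametrisation datum `P` of `W` by `X₀^D(M)` yields,
for EVERY Néron-type period pair `L` of `W` (all span `Λ_{P.L}`,
`lattice_eq_of_isNeronLatticeOf`): a weight-`2` form `h = P.form` on `Γ₀^D(M)` with periods in
`Λ_L`, in the Hecke line of `W` away from `D M`, and a degree `d = P.deg ≥ 1` such that all but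
finitely many classes of `ℂ/Λ_L` have exactly `d` orbits `Γ₀^D(M)τ` with
`∫_{τ₀}^τ h ≡ ·  (mod Λ_L)` — the field `deg_spec` transported back along
`QuotientAddGroup.liftEquiv : ℂ/Λ_L ≃+ W(ℂ)` induced by `P.uniformize`. (So the automorphic half
asks for nothing beyond the structure; the Shimura-curve twin of the tree's
`ModularParametrizationData.exists_maninConstant_modularDegree`.) [folklore] -/
theorem automorphicHalf (P : ShimuraParametrizationData X W) {L : PeriodPair}
    (hL : IsNeronLatticeOf (W.baseChange ℂ) L) :
    ∃ (h : CuspForm X.Gamma 2) (τ₀ : ℍ) (d : ℕ),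
      HasPeriodsIn X.Gamma h (L.lattice : Set ℂ) ∧
      (∀ ℓ : ℕ, ℓ.Prime → ¬ ℓ ∣ D * M →
        X.heckeFun ℓ h = fun τ => ((W.LFunction ℓ : ℤ) : ℂ) * h τ) ∧
      0 < d ∧
      {c : ℂ ⧸ L.lattice.toAddSubgroup |
        Nat.card {y : MulAction.orbitRel.Quotient X.Gamma ℍ // ∃ τ : ℍ,
          (Quotient.mk _ τ : MulAction.orbitRel.Quotient X.Gamma ℍ) = y ∧
            ((segmentIntegral h τ₀ τ : ℂ) : ℂ ⧸ L.lattice.toAddSubgroup) = c} ≠ d}.Finite := by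
  have hLL : L.lattice = P.L.lattice := P.lattice_eq_of_isNeronLatticeOf hL
  have hker' : L.lattice.toAddSubgroup = P.uniformize.ker :=
    SetLike.coe_injective (by rw [Submodule.coe_toAddSubgroup, hLL, P.ker_uniformize])
  let e : ℂ ⧸ L.lattice.toAddSubgroup ≃+ (W.baseChange ℂ).toAffine.Point :=
    QuotientAddGroup.liftEquiv L.lattice.toAddSubgroup P.uniformize_surjective hker'
  have he : ∀ x : ℂ, e.toEquiv (x : ℂ ⧸ L.lattice.toAddSubgroup) = P.uniformize x := fun _ ↦ rfl
  refine ⟨P.form, P.basePoint, P.deg, hLL ▸ P.period_mem, P.hecke_eq, P.deg_pos, ?_⟩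
  refine (finite_setOf_card_orbitFibre_ne_iff
    (fun τ : ℍ ↦ (Quotient.mk _ τ : MulAction.orbitRel.Quotient X.Gamma ℍ)) e.toEquiv
    (fun τ : ℍ ↦ ((segmentIntegral P.form P.basePoint τ : ℂ) : ℂ ⧸ L.lattice.toAddSubgroup))
    P.deg).mp ?_
  simp only [he]
  exact P.deg_spec

end ShimuraParametrizationData

/-! ### The assembly: the fact from its automorphic half -/

/-- **`nonempty_shimuraParametrizationData` from its automorphic half.** Hypothesis `hJL` (the
automorphic half, on `ℂ/Λ_L`): for every admissible `N = D M`, every datum `X` of level `(D, M)`,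
every globally minimal elliptic `W/ℚ` of conductor `N` and every Néron-type period pair `L` of `W`,
there are `h ∈ S₂(Γ₀^D(M))` with periods in `Λ_L` and `T_ℓ h = a_ℓ(W) h` for primes `ℓ ∤ D M`,
a base point `τ₀` and `d ≥ 1` such that all but finitely many classes of `ℂ/Λ_L` have exactly `d`
orbits `Γ₀^D(M)τ` with `∫_{τ₀}^τ h` in the class — Pasten §2 p. 12 (Jacquet–Langlands optimal
quotient `q_{D,M}`, `A_{D,M} ∼ E`), §4.10–4.11 p. 16, proof of Prop. 5.1 p. 17 (`q j_{p₀}` has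
degree `δ_{D,M}`), composed with an isogeny `A_{D,M} → W` and pulled back to `ℍ`; mathematically
Modularity + Jacquet–Langlands + Shimura's construction + Faltings + the degree of a map of compact
Riemann surfaces, none of which is a theorem of the tree for `X.Gamma`. Conclusion: the fact. Proof:
the Néron-type period pair exists (`exists_isNeronLatticeOf_holds`, AEC VI.5.1), the uniformisation
`ℂ →+ W(ℂ)` with kernel `Λ_L` exists (`PeriodPair.exists_addMonoidHom_of_g₂_g₃'`, AEC VI.3.6(b)),
and the fibre count of `hJL` is transported along `QuotientAddGroup.liftEquiv : ℂ/Λ_L ≃+ W(ℂ)`.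
[cite: PastenShimura2024, §2 p. 12 and §4.10 p. 16 and Prop. 5.1 p. 17]
[cite: SilvermanAEC2009, Prop. VI.3.6(b) and Thm. VI.5.1] -/
theorem nonempty_shimuraParametrizationData_of_automorphicHalf
    (hJL : ∀ {N D M : ℕ}, IsAdmissibleFactorization N D M →
      ∀ (X : ShimuraCurveData D M) (W : WeierstrassCurve ℚ) [W.IsElliptic] [W.IsGloballyMinimal],
        W.conductorNorm ℤ = N → ∀ {L : PeriodPair}, IsNeronLatticeOf (W.baseChange ℂ) L →
        ∃ (h : CuspForm X.Gamma 2) (τ₀ : ℍ) (d : ℕ),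
          HasPeriodsIn X.Gamma h (L.lattice : Set ℂ) ∧
          (∀ ℓ : ℕ, ℓ.Prime → ¬ ℓ ∣ D * M →
            X.heckeFun ℓ h = fun τ => ((W.LFunction ℓ : ℤ) : ℂ) * h τ) ∧
          0 < d ∧
          {c : ℂ ⧸ L.lattice.toAddSubgroup |
            Nat.card {y : MulAction.orbitRel.Quotient X.Gamma ℍ // ∃ τ : ℍ,
              (Quotient.mk _ τ : MulAction.orbitRel.Quotient X.Gamma ℍ) = y ∧
                ((segmentIntegral h τ₀ τ : ℂ) : ℂ ⧸ L.lattice.toAddSubgroup) = c} ≠ d}.Finite) :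
    nonempty_shimuraParametrizationData := by
  intro N D M hNDM X W _ _ hN
  haveI : (W.baseChange ℂ).IsElliptic := by rw [WeierstrassCurve.baseChange]; infer_instance
  obtain ⟨L, hL⟩ := exists_isNeronLatticeOf_holds (W.baseChange ℂ)
  obtain ⟨u, hker, hsurj, hspec⟩ := PeriodPair.exists_addMonoidHom_of_g₂_g₃' hL.1 hL.2
  obtain ⟨h, τ₀, d, hper, hhecke, hd, hfin⟩ := hJL hNDM X W hN hL
  have hker' : L.lattice.toAddSubgroup = u.ker :=
    SetLike.coe_injective (by rw [Submodule.coe_toAddSubgroup, hker])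
  let e : ℂ ⧸ L.lattice.toAddSubgroup ≃+ (W.baseChange ℂ).toAffine.Point :=
    QuotientAddGroup.liftEquiv L.lattice.toAddSubgroup hsurj hker'
  have he : ∀ x : ℂ, e.toEquiv (x : ℂ ⧸ L.lattice.toAddSubgroup) = u x := fun _ ↦ rfl
  have key := (finite_setOf_card_orbitFibre_ne_iff
    (fun τ : ℍ ↦ (Quotient.mk _ τ : MulAction.orbitRel.Quotient X.Gamma ℍ)) e.toEquiv
    (fun τ : ℍ ↦ ((segmentIntegral h τ₀ τ : ℂ) : ℂ ⧸ L.lattice.toAddSubgroup)) d).mpr hfin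
  simp only [he] at key
  exact ⟨{
    L := L
    isNeronLattice := hL
    uniformize := u
    ker_uniformize := hker
    uniformize_surjective := hsurj
    uniformize_spec := hspec
    form := h
    basePoint := τ₀
    period_mem := hper
    hecke_eq := hhecke
    deg := d
    deg_pos := hd
    deg_spec := key }⟩

/-- **`nonempty_shimuraParametrizationData` is equivalent to its automorphic half** (stated on
`ℂ/Λ_L`, for every Néron-type period pair `L`): `→` by
`ShimuraParametrizationData.automorphicHalf` (a datum serves every `L`, the Néron-type lattice
being unique, AEC VI.5.1), `←` by `nonempty_shimuraParametrizationData_of_automorphicHalf`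
(AEC VI.3.6(b), VI.5.1). Hence the named fact is open exactly until the Jacquet–Langlands /
Shimura-construction statement on the right — Pasten §2 p. 12, §4.10–4.11 p. 16, Prop. 5.1 p. 17 —
is a theorem for the groups `ι(O¹)`. [cite: PastenShimura2024, §2 p. 12 and §4.10 p. 16 and Prop. 5.1 p. 17]
[cite: SilvermanAEC2009, Prop. VI.3.6(b) and Thm. VI.5.1] -/
theorem nonempty_shimuraParametrizationData_iff_automorphicHalf :
    nonempty_shimuraParametrizationData ↔
    ∀ {N D M : ℕ}, IsAdmissibleFactorization N D M →
      ∀ (X : ShimuraCurveData D M) (W : WeierstrassCurve ℚ) [W.IsElliptic] [W.IsGloballyMinimal],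
        W.conductorNorm ℤ = N → ∀ {L : PeriodPair}, IsNeronLatticeOf (W.baseChange ℂ) L →
        ∃ (h : CuspForm X.Gamma 2) (τ₀ : ℍ) (d : ℕ),
          HasPeriodsIn X.Gamma h (L.lattice : Set ℂ) ∧
          (∀ ℓ : ℕ, ℓ.Prime → ¬ ℓ ∣ D * M →
            X.heckeFun ℓ h = fun τ => ((W.LFunction ℓ : ℤ) : ℂ) * h τ) ∧
          0 < d ∧
          {c : ℂ ⧸ L.lattice.toAddSubgroup |
            Nat.card {y : MulAction.orbitRel.Quotient X.Gamma ℍ // ∃ τ : ℍ,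
              (Quotient.mk _ τ : MulAction.orbitRel.Quotient X.Gamma ℍ) = y ∧
                ((segmentIntegral h τ₀ τ : ℂ) : ℂ ⧸ L.lattice.toAddSubgroup) = c} ≠ d}.Finite :=
  ⟨fun hP _ _ _ hNDM X W _ _ hN _ hL ↦ (hP hNDM X W hN).some.automorphicHalf hL,
    nonempty_shimuraParametrizationData_of_automorphicHalf⟩

end Literature.NumberTheory.Automorphic

end
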